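import Summits.BirchSwinnertonDyer.BirchSwinnertonDyer.Theorems.AdditiveBranchIMCGordTwoRankZeroOffCaseOneFieldSupplyR0
import Literature.NumberTheory.EllipticCurves.NonvanishingTwistsPrescribedRamificationSplit
import HarnessLib

/-!
# Registered stub `stub_tameRoadField` of line `wan-tame-bdp-road` (v4) — PROVED, BY NAME AND SIGNATURE
# (crux `AdditiveBranchIMC.GordTwoRankOne`, stmt-BirchSwinnertonDyer-19358, route K1 `AdditiveBranchIMC`;
# stub-worker `bsd-line-k1tame-w1-g0` under LEAD `cruxlead-19358`)

HONEST FRAMING. One theorem adapting the PROVED helper `exists_fieldOne_gordTwo_rankZero` (p660096,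
ThreeFieldRoadSupply) for the rank-1 case, using `friedbergHoffstein_exists_twist_ne_zero_ramifiedAt_splitAt`
(F5) in place of the simple-zero variant (F6). LINE VOCABULARY repeated verbatim from the skeleton
`Cruxes/GordTwoRankOne/Lines/wan_tame_bdp_road.lean` v4 — `WanPrime`, `TameRoadRow`, `TameRoadField`,
and the cite-only conjunction `PrintedFactsTame` (13 conjuncts) — so that the stub can be stated by name
and signature under the Theorems import fence; the constants are definitionally equal to the skeleton's,
nothing is asserted by them. No named fact, no `sorry`; BSD is proved for no curve; the crux item stays OPEN.

THE STUB (FIELD AND TWIST). On the sub-row `TameRoadRow` in analytic rank `1`: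
Parity gives `w(E) = -1`; F5 at the Wan prime `q` and the auxiliary prime `p` gives the tame-road field
`K` and `L(E^{(d_K)}, 1) ≠ 0`; the globally minimal twist `Wd` has `r_an = 0`, lies on the (G-ord, `e = 2`)
cell (`p*`-partners), `ρ̄` onto.

References: [cite: FriedbergHoffstein1995, Thm. B] [cite: Castella2018, §5 (arXiv:1704.06608 p. 12)]
[cite: SilvermanAEC2009, X.5 Cor. 5.4, VII.6.1].
Axioms: `propext`, `Classical.choice`, `Quot.sound`.
-/

set_option autoImplicit false
set_option linter.dupNamespace false

noncomputable section

open scoped Classical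

open NumberField IsDedekindDomain
open WeierstrassCurve Literature.NumberTheory.EllipticCurves
  Literature.NumberTheory.EllipticCurves.ModularForms
  Literature.NumberTheory.EllipticCurves.Rank1Residual
  Literature.NumberTheory.EllipticCurves.Rank1Residual.Typed
open Summit.BirchSwinnertonDyer.Rank1Residual
open Summit.BirchSwinnertonDyer.Rank1Residual.Additive
open Summit.BirchSwinnertonDyer.BirchSwinnertonDyer.Theorems.ThreeFieldRoadSupply

namespace Summit.BirchSwinnertonDyer.BirchSwinnertonDyer.Theorems.WanTameBdpRoadSupply

/-! ### Line vocabulary (verbatim from the skeleton wan_tame_bdp_road.lean v4; nothing asserted) -/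

/-- The WAN PRIME: `q ≠ p`, `q ≠ 2`, NON-SPLIT multiplicative for `E` (`a_q = −1`), `ρ̄_{E,p}` ramified at
`q` (`p ∤ v_q(Δ_min)`). Verbatim the skeleton's `WanPrime`. [predicate; nothing asserted] -/
def WanPrime (W : WeierstrassCurve ℚ) [W.IsGloballyMinimal] (p q : ℕ) [Fact q.Prime] : Prop :=
  q ≠ p ∧ q ≠ 2 ∧ W.HasMultiplicativeReductionAtPrime q ∧ ¬ W.HasSplitMultiplicativeReductionAtPrime q ∧
    ¬ p ∣ padicValInt q W.minimalDiscriminantInt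

/-- The tame sub-row: `p ≥ 5`, `ρ̄_{E,p}` onto, `E` semistable outside `p`, a Wan prime. Verbatim the
skeleton's `TameRoadRow`. [predicate; nothing asserted] -/
def TameRoadRow (W : WeierstrassCurve ℚ) [W.IsGloballyMinimal] (p : ℕ) [Fact p.Prime] : Prop :=
  5 ≤ p ∧ Surj W p ∧
    (∀ ℓ : ℕ, (hℓ : ℓ.Prime) → ℓ ≠ p →
      (haveI : Fact ℓ.Prime := ⟨hℓ⟩;
        W.HasGoodReductionAtPrime ℓ ∨ W.HasMultiplicativeReductionAtPrime ℓ)) ∧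
    ∃ q : ℕ, ∃ _ : Fact q.Prime, WanPrime W p q

/-- THE TAME-ROAD FIELD at `(E, p)`: imaginary quadratic `K`, a Wan prime `q` ramified, every other prime
of `N_E` split, `2` split if `2 ∤ N_E`, `p` split. Verbatim the skeleton's `TameRoadField`.
[predicate; nothing asserted] -/
def TameRoadField (W : WeierstrassCurve ℚ) [W.IsGloballyMinimal] (p : ℕ)
    (K : Type) [Field K] [NumberField K] : Prop :=
  IsImaginaryQuadratic K ∧
    (∃ q : ℕ, ∃ _ : Fact q.Prime, WanPrime W p q ∧ (q : ℤ) ∣ NumberField.discr K ∧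
      ∀ ℓ : ℕ, ℓ.Prime → ℓ ∣ W.conductorNorm ℤ → ℓ ≠ q →
        ((Ideal.span {(ℓ : ℤ)}).primesOver (𝓞 K)).ncard = 2) ∧
    (¬ 2 ∣ W.conductorNorm ℤ → ((Ideal.span {(2 : ℤ)}).primesOver (𝓞 K)).ncard = 2) ∧
    SatisfiesHeegnerHypothesis p K

/-- The printed theorems the road consumes BY NAME — cite-only conjunction, VERBATIM the skeleton's
`PrintedFactsTame` (v4, thirteen conjuncts). Line vocabulary repeated so that the registered stub can be
stated by name and signature under the Theorems import fence; NOTHING IS ASSERTED (each conjunct is an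
existing tree `Prop`, cited where it is declared). -/
def PrintedFactsTame : Prop :=
  Wuthrich2014.kato_halfEigenCharIdeal_dvd_cyclotomicPrime_of_surjective ∧
    Delbourgo1998.prop4_rankZero_pow_dvd_constantCoeff ∧
    Literature.NumberTheory.EllipticCurves.rank_eq_analyticRank_of_analyticRank_le_one ∧
    WeierstrassCurve.hasEntireLFunction_rat ∧
    Literature.NumberTheory.EllipticCurves.ModularForms.nonempty_modularParametrizationData ∧
    friedbergHoffstein_exists_twist_ne_zero_ramifiedAt_splitAt ∧
    (∀ W : WeierstrassCurve ℚ,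
      Literature.NumberTheory.EllipticCurves.even_analyticRank_iff_rootNumber_eq_one W) ∧
    WeierstrassCurve.bsdRHS_eq_of_isIsogenous ∧
    Literature.NumberTheory.EllipticCurves.GrossZagier1986_thm_I_7_3 ∧
    CaiShuTian2014.thm11_trivialChar ∧
    Hsieh2014.thmA_exists_isHsiehLFunction_unrPeriod_ramifiedSteinberg ∧
    Hsieh2014.thmB_exists_isHsiehLFunction_coeff_norm_eq_one_unrPeriod_ramifiedSteinberg ∧
    LiuZhangZhang2018.thm151_thm153_modularCurve_heegnerVector_additive_ramifiedSteinberg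

/-! ### The main helper: FIELD 1 on the (G-ord, e = 2) cell, analytic rank 1 -/

variable (W : WeierstrassCurve ℚ) [W.IsElliptic] [W.IsGloballyMinimal] (p : ℕ) [hp : Fact p.Prime]

/-- **FIELD 1 on the (G-ord, `e = 2`) cell, analytic rank `1`** (the `(K, Wd)` of `stub_tameRoadField`
of line `wan-tame-bdp-road` v4, with `TameRoadField` spelled out). For `(E, p)` on the cell with `p ≥ 5`,
`ρ̄_{E,p}` onto, `r_an(E) = 1`, and a Wan prime `q` (`q ≠ p`, `q ≠ 2`, non-split multiplicative,
`p ∤ v_q(Δ_min)`): parity gives `w(E) = -1`; F5 (`friedbergHoffstein_exists_twist_ne_zero_ramifiedAt_splitAt`)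
an imaginary quadratic `K` with `q` ramified, every other bad prime split, `2` split if `2 ∤ N`, `p` split and
`L(E^{(d_K)}, 1) ≠ 0`; a globally minimal model `Wd` of the twist has `r_an = 0`
(modularity), lies on the cell (§1 transport), has `ρ̄` onto.
[cite: FriedbergHoffstein1995, Thm. B (first alternative)] [cite: Castella2018, §5 (arXiv:1704.06608 p. 12)]
[cite: SilvermanAEC2009, X.5 Cor. 5.4 and Thm VII.6.1] -/
theorem exists_fieldOne_gordTwo_rankOne
    (hF5 : friedbergHoffstein_exists_twist_ne_zero_ramifiedAt_splitAt)
    (hpar : ∀ X : WeierstrassCurve ℚ, even_analyticRank_iff_rootNumber_eq_one X)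
    (hmod : hasEntireLFunction_rat)
    (hp5 : 5 ≤ p) (hr : W.analyticRank = 1) (hcell : N10.CellGordTwo W p) (hsurj : Surj W p)
    {q : ℕ} [Fact q.Prime] (hqp : q ≠ p) (hq2 : q ≠ 2)
    (hqm : W.HasMultiplicativeReductionAtPrime q) (hqns : ¬ W.HasSplitMultiplicativeReductionAtPrime q)
    (_hqv : ¬ p ∣ padicValInt q W.minimalDiscriminantInt) :
    ∃ (K : Type) (_ : Field K) (_ : NumberField K)
      (Wd : WeierstrassCurve ℚ) (_ : Wd.IsElliptic) (_ : Wd.IsGloballyMinimal),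
      IsImaginaryQuadratic K ∧ (q : ℤ) ∣ NumberField.discr K ∧
        (∀ ℓ : ℕ, ℓ.Prime → ℓ ∣ W.conductorNorm ℤ → ℓ ≠ q →
          ((Ideal.span {(ℓ : ℤ)}).primesOver (𝓞 K)).ncard = 2) ∧
        (¬ 2 ∣ W.conductorNorm ℤ → ((Ideal.span {(2 : ℤ)}).primesOver (𝓞 K)).ncard = 2) ∧
        SatisfiesHeegnerHypothesis p K ∧
        ((Ideal.span {(2 : ℤ)}).primesOver (𝓞 K)).ncard = 2 ∧
        (∃ C : VariableChange ℚ, C • W.quadraticTwist (NumberField.discr K : ℚ) = Wd) ∧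
        (W.quadraticTwist (NumberField.discr K : ℚ)).entireLFunction 1 ≠ 0 ∧
        Wd.analyticRank = 0 ∧ N10.CellGordTwo Wd p ∧ Surj Wd p := by
  -- Parity: r_an = 1 ⟹ w(E) = -1
  have hw : W.rootNumber = -1 := (rootNumber_of_analyticRank_le_one W hpar).2 hr
  -- F5 gives the field K with L(E^{(d_K)},1) ≠ 0
  obtain ⟨K, iF, iN, hK, -, hqd, hsplit, h2, hpK, hL⟩ :=
    hF5 W hw q hqm hqns p hp.out hqp.symm 0
  -- `2` splits in `K` in either case
  have h2K : ((Ideal.span {(2 : ℤ)}).primesOver (𝓞 K)).ncard = 2 := by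
    by_cases h2N : 2 ∣ W.conductorNorm ℤ
    · exact hsplit 2 Nat.prime_two h2N (Ne.symm hq2)
    · exact h2 h2N
  have hD0 : (NumberField.discr K : ℚ) ≠ 0 := by exact_mod_cast NumberField.discr_ne_zero K
  obtain ⟨Wd, iWd, iWdm, Cd', hCd'⟩ := exists_isGloballyMinimal_smul_eq_quadraticTwist W hD0
  have hWd : Cd'⁻¹ • W.quadraticTwist (NumberField.discr K : ℚ) = Wd := by rw [← hCd', inv_smul_smul]
  refine ⟨K, iF, iN, Wd, iWd, iWdm, hK, hqd, hsplit, h2, hpK, h2K, ⟨Cd'⁻¹, hWd⟩, hL, ?_, ?_, ?_⟩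
  · -- r_an(Wd) = 0 from L(E^{(d_K)},1) ≠ 0
    exact analyticRank_eq_zero_tameTwist W K hmod Cd'⁻¹ hWd hL
  · -- Cell transport
    exact cellGordTwo_tameTwist W p K hp5 hK hpK h2K Cd'⁻¹ hWd hcell
  · -- Surj transport
    exact surj_tameTwist W p K Cd'⁻¹ hWd hsurj

/-! ### The stub -/

/-- **Registered stub `stub_tameRoadField` of line `wan-tame-bdp-road`** (crux `GordTwoRankOne`,
stmt-BirchSwinnertonDyer-19358), BY NAME AND SIGNATURE — THE FIELD AND THE TWIST: on the sub-row in
analytic rank `1`, a tame-road field `K` with a globally minimal rank-zero twist `Wd` on the same cell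
(`ClassX4Gord`, `e = 2`, `ρ̄` onto) and `L(E^{(d_K)}, 1) ≠ 0`. Proof: parity (`w(E) = -1` from `r_an = 1`),
then `exists_fieldOne_gordTwo_rankOne` (F5 at the Wan prime and `p`, transport lemmas from §1 of
`ThreeFieldRoadSupply`).
[cite: FriedbergHoffstein1995, Thm. B] [cite: Castella2018, §5 (arXiv:1704.06608 p. 12)]
[cite: SilvermanAEC2009, X.5 Cor. 5.4 and Thm VII.6.1] -/
theorem stub_tameRoadField : PrintedFactsTame →
    ∀ (W : WeierstrassCurve ℚ) [W.IsElliptic] [W.IsGloballyMinimal] (p : ℕ) [Fact p.Prime],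
      W.analyticRank = 1 → N10.CellGordTwo W p → TameRoadRow W p →
        ∃ (K : Type) (_ : Field K) (_ : NumberField K)
          (Wd : WeierstrassCurve ℚ) (_ : Wd.IsElliptic) (_ : Wd.IsGloballyMinimal),
          TameRoadField W p K ∧
          (∃ C : VariableChange ℚ, C • W.quadraticTwist (NumberField.discr K : ℚ) = Wd) ∧
          (W.quadraticTwist (NumberField.discr K : ℚ)).entireLFunction 1 ≠ 0 ∧
          Wd.analyticRank = 0 ∧ ClassX4Gord Wd p ∧ semistabilityIndex Wd p = 2 ∧ Surj Wd p := by
  intro hF W _ _ p _ hr hcell hrow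
  -- Unpack PrintedFactsTame for the facts we need
  obtain ⟨-, -, -, hmod, -, hF5, hpar, -, -, -, -, -, -⟩ := hF
  -- Unpack TameRoadRow for the Wan prime
  obtain ⟨hp5, hsurj, -, q, hqF, hqp, hq2, hqm, hqns, hqv⟩ := hrow
  -- Apply the main helper
  obtain ⟨K, iF, iN, Wd, iWd, iWdm, hK, hqd, hsplit, h2, hpK, h2K, htw, hL, hrd, hcelld, hsurjd⟩ :=
    exists_fieldOne_gordTwo_rankOne W p hF5 hpar hmod hp5 hr hcell hsurj hqp hq2 hqm hqns hqv
  -- Build TameRoadField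
  have hTRF : TameRoadField W p K := ⟨hK, ⟨q, hqF, ⟨hqp, hq2, hqm, hqns, hqv⟩, hqd, hsplit⟩, h2, hpK⟩
  -- Extract ClassX4Gord from CellGordTwo
  have hX4 : ClassX4Gord Wd p := by
    constructor
    · -- ClassX4 = (p ≠ 2) ∧ Addv ∧ Irr
      refine ⟨hcelld.1, hcelld.2.1, ?_⟩
      exact hasIrreducibleModPGaloisRep_of_hasSurjectiveModNGaloisRep Wd p hsurjd
    · -- TypeGOrd
      exact hcelld.2.2.1
  -- e = 2 is part of CellGordTwo
  have hed : semistabilityIndex Wd p = 2 := hcelld.2.2.2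
  exact ⟨K, iF, iN, Wd, iWd, iWdm, hTRF, htw, hL, hrd, hX4, hed, hsurjd⟩

end Summit.BirchSwinnertonDyer.BirchSwinnertonDyer.Theorems.WanTameBdpRoadSupply

end
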